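import Summits.ResolutionOfSingularities.ResolutionOfSingularities.Theorems.FrobeniusLadderFInjectiveMacaulayficationPencilFedder
import Summits.ResolutionOfSingularities.ResolutionOfSingularities.Theorems.FrobeniusLadderFInjectiveMacaulayficationPencilPhiPrime
import HarnessLib

/-!
# BED Ω, GLOBAL PATCH (g-b), F4 (c) TEMPLATE ON THE ACTUAL CHART 22 OF `X̃_{B9}`: the two pencil chart rings of `S′_{Ω₁} = Bl_𝒥 X̃` over `U₂₂` are codimension-2 complete intersections
# `k[y₃, y₀, y₁, y₂, y₄, W]/(θ₂₂, y₃²²y₄⁴³·W − (y₀²y₂ − y₁³))` and `…/(θ₂₂, (y₀²y₂ − y₁³)·U − y₃²²y₄⁴³)`, Cohen–Macaulay AT EVERY STALK, every field — no étale leg needed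
# (crux `FInjectiveMacaulayfication` stmt-ResolutionOfSingularities-15315, chain w45a; R23.23 (1) file F4 (c); `g13/GLOBAL-PATCH-PLAN.md` v2 addendum «F4 (c) via ACTUAL charts»; letters from
# res-L1-w45a-stub-1 g15 ✓p703845 `B9OmegaChartLetters` (chart 22: `θ₂₂ = y₃ + 1 + y₀⁹ + y₁⁹ + y₂⁹`, `𝒥 = y₃³y₄⁶·(y₃²²y₄⁴³, y₀²y₂ − y₁³)`); seat res-L1-w45a-stub-3 g13)

[OURS · L1 W4.5a] Support file (`--supports stmt-ResolutionOfSingularities-15315 --as helper`); theorems only; no named fact; NOT a statement of any manuscript; nothing of the crux is proved.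
WHAT IS AND IS NOT HERE: the rings below are the Stacks-0BIQ presentations of the two Rees charts of `Bl_{(a′, b′)}(U₂₂ ∩ X̃)`, `(a′, b′) = (y₃²²y₄⁴³, y₀²y₂ − y₁³)` = `𝒥|_{U₂₂}` with its invertible
factor `y₃³y₄⁶` removed (✓ `isBlowup_span_singleton_mul_iff`); the IDENTIFICATION of `S′|_{U₂₂}` with these schemes (chart formula `ideal_comap_idealSheaf` + ✓ `blowupAlgebra.quotientSpanRelEquiv`)
is the F4 (c) GLUE and is NOT done in this file. LETTERS (a permutation of ✓p703845ʼs, so that the `y₃`-linear `θ₂₂` has its linear variable first): `X 0 = y₃`, `X 1 = y₀`, `X 2 = y₁`,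
`X 3 = y₂`, `X 4 = y₄`, `X 5 = W` (resp. `U`).
* `prime_theta22` (`θ₂₂` is prime: linear with unit coefficient, ✓ `prime_pencilPhiAffine` with `M = 1`), `theta22_not_dvd_monomial`, `theta22_not_dvd_cusp` (evaluation points),
  ★ `cmCl_actualChart22_W`, ★ `cmCl_actualChart22_U` (✓ `CICodimTwoCM.cmCl_stalk_of_prime_of_not_dvd` + ✓ `PencilFedder.not_dvd_pencil_of_not_dvd`).
[cite: StacksProject, Tag 0BIQ; Matsumura1987, Thm. 17.4 (CI in a CM ring)]
-/

set_option linter.dupNamespace false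

noncomputable section

open AlgebraicGeometry MvPolynomial

namespace Summit.ResolutionOfSingularities.ResolutionOfSingularities.Theorems.FInjectiveMacaulayfication.OmegaOneActualChart22CM

open Summit.ResolutionOfSingularities.ResolutionOfSingularities.Theorems.FInjectiveMacaulayfication
open SliceableCentre

variable (k : Type) [Field k]

/-- **`θ₂₂ = y₃ + 1 + y₀⁹ + y₁⁹ + y₂⁹` IS PRIME** in `k[y₃, y₀, y₁, y₂, y₄, W]` (linear in `y₃` with unit coefficient). [elementary; ✓ `prime_pencilPhiAffine` with `M = 1`] -/
theorem prime_theta22 : Prime (X 0 + C 1 + X 1 ^ 9 + X 2 ^ 9 + X 3 ^ 9 : MvPolynomial (Fin 6) k) := by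
  have h := PencilPhiPrime.prime_pencilPhiAffine k (1 : MvPolynomial (Fin 5) k) (-(C 1 + X 0 ^ 9 + X 1 ^ 9 + X 2 ^ 9)) one_ne_zero
    (fun t _ => by rw [Ideal.span_singleton_one]; exact Submodule.mem_top)
  have he : (rename Fin.succ (1 : MvPolynomial (Fin 5) k) * X 0 - rename Fin.succ (-(C 1 + X 0 ^ 9 + X 1 ^ 9 + X 2 ^ 9)) : MvPolynomial (Fin 6) k) =
      X 0 + C 1 + X 1 ^ 9 + X 2 ^ 9 + X 3 ^ 9 := by
    simp only [map_one, map_neg, map_add, map_pow, rename_X]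
    have h1 : (Fin.succ (0 : Fin 5) : Fin 6) = 1 := rfl
    have h2 : (Fin.succ (1 : Fin 5) : Fin 6) = 2 := rfl
    have h3 : (Fin.succ (2 : Fin 5) : Fin 6) = 3 := rfl
    rw [h1, h2, h3]; ring
  rwa [he] at h

/-- `θ₂₂ ∤ y₃²²y₄⁴³` (evaluate at `y₃ = −1`, `y₄ = 1`, rest `0`: `θ₂₂ ↦ 0`, the monomial `↦ 1`). [elementary] -/
theorem theta22_not_dvd_monomial : ¬ (X 0 + C 1 + X 1 ^ 9 + X 2 ^ 9 + X 3 ^ 9 : MvPolynomial (Fin 6) k) ∣ X 0 ^ 22 * X 4 ^ 43 := by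
  rintro ⟨q, hq⟩
  have h := congrArg (eval (![-1, 0, 0, 0, 1, 0] : Fin 6 → k)) hq
  simp [eval_X] at h

/-- `θ₂₂ ∤ y₀²y₂ − y₁³` (evaluate at `y₃ = −3`, `y₀ = y₂ = 1`, rest `0`: `θ₂₂ ↦ 0`, the cusp `↦ 1`). [elementary] -/
theorem theta22_not_dvd_cusp : ¬ (X 0 + C 1 + X 1 ^ 9 + X 2 ^ 9 + X 3 ^ 9 : MvPolynomial (Fin 6) k) ∣ X 1 ^ 2 * X 3 - X 2 ^ 3 := by
  rintro ⟨q, hq⟩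
  have h := congrArg (eval (![-3, 1, 0, 1, 0, 0] : Fin 6 → k)) hq
  simp [eval_X] at h
  norm_num at h

/-- ★ **THE ACTUAL `W`-CHART OF `S′_{Ω₁}` OVER `U₂₂` IS COHEN–MACAULAY AT EVERY STALK**: `k[y₃,y₀,y₁,y₂,y₄,W]/(θ₂₂, y₃²²y₄⁴³·W − (y₀²y₂ − y₁³))`, any field `k`.
[OURS · F4 (c) template; cite: StacksProject, Tag 0BIQ; Matsumura1987, Thm. 17.4] -/
theorem cmCl_actualChart22_W
    (y : Spec (.of (MvPolynomial (Fin 6) k ⧸ Ideal.span {(X 0 + C 1 + X 1 ^ 9 + X 2 ^ 9 + X 3 ^ 9 : MvPolynomial (Fin 6) k), X 0 ^ 22 * X 4 ^ 43 * X 5 - (X 1 ^ 2 * X 3 - X 2 ^ 3)}))) :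
    CMCl ((Spec (.of (MvPolynomial (Fin 6) k ⧸ Ideal.span {(X 0 + C 1 + X 1 ^ 9 + X 2 ^ 9 + X 3 ^ 9 : MvPolynomial (Fin 6) k), X 0 ^ 22 * X 4 ^ 43 * X 5 - (X 1 ^ 2 * X 3 - X 2 ^ 3)}))).presheaf.stalk y) :=
  CICodimTwoCM.cmCl_stalk_of_prime_of_not_dvd k _ _ (prime_theta22 k)
    (PencilFedder.not_dvd_pencil_of_not_dvd k 5 _ _ _ (by simp [pderiv_X]) (by simp [pderiv_X]) (by simp [pderiv_X]) (theta22_not_dvd_monomial k)) y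

/-- ★ **THE ACTUAL `U`-CHART OF `S′_{Ω₁}` OVER `U₂₂` IS COHEN–MACAULAY AT EVERY STALK**: `k[y₃,y₀,y₁,y₂,y₄,U]/(θ₂₂, (y₀²y₂ − y₁³)·U − y₃²²y₄⁴³)`, any field `k`.
[OURS · F4 (c) template; cite: StacksProject, Tag 0BIQ; Matsumura1987, Thm. 17.4] -/
theorem cmCl_actualChart22_U
    (y : Spec (.of (MvPolynomial (Fin 6) k ⧸ Ideal.span {(X 0 + C 1 + X 1 ^ 9 + X 2 ^ 9 + X 3 ^ 9 : MvPolynomial (Fin 6) k), (X 1 ^ 2 * X 3 - X 2 ^ 3) * X 5 - X 0 ^ 22 * X 4 ^ 43}))) :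
    CMCl ((Spec (.of (MvPolynomial (Fin 6) k ⧸ Ideal.span {(X 0 + C 1 + X 1 ^ 9 + X 2 ^ 9 + X 3 ^ 9 : MvPolynomial (Fin 6) k), (X 1 ^ 2 * X 3 - X 2 ^ 3) * X 5 - X 0 ^ 22 * X 4 ^ 43}))).presheaf.stalk y) :=
  CICodimTwoCM.cmCl_stalk_of_prime_of_not_dvd k _ _ (prime_theta22 k)
    (PencilFedder.not_dvd_pencil_of_not_dvd k 5 _ _ _ (by simp [pderiv_X]) (by simp [pderiv_X]) (by simp [pderiv_X]) (theta22_not_dvd_cusp k)) y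

end Summit.ResolutionOfSingularities.ResolutionOfSingularities.Theorems.FInjectiveMacaulayfication.OmegaOneActualChart22CM

end
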